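import Summits.QuantumFields.BalabanUV.T4Continuum.Support.NE7ApeCurvedRepRoadBScalarFreeEnd
import Summits.QuantumFields.BalabanUV.T4Continuum.Support.NE7ConstrainedGreenSymmetricMass
import Summits.QuantumFields.BalabanUV.T4Continuum.Support.NE7BalabanSliceSourceDuality
import Summits.QuantumFields.BalabanUV.T4Continuum.Support.NE7TensionRadiusOfFluxGradient
import HarnessLib
import Summits.QuantumFields.BalabanUV.T4Continuum.Support.NE7ApeCurvedRepRoadBPositivityMassEnd
import Summits.QuantumFields.BalabanUV.T4Continuum.Support.NE7LandauCorrection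
import Summits.QuantumFields.BalabanUV.T4Continuum.Support.NE7ApeCurvedRepRoadBSlicePoincareEnd
import Summits.QuantumFields.BalabanUV.T4Continuum.Support.NE7SlicePoincareTA
import Summits.QuantumFields.BalabanUV.T4Continuum.Support.NE7ApeCurvedRepRoadBFrameFreeEnd
import Summits.QuantumFields.BalabanUV.T4Continuum.Support.NE7SlicePoincareTAClass

/-!
# NE7ApeCurvedRepRoadBClassEnd — THE CURVED (APE) WITH ITS POSITIVITY LETTER DISCHARGED ON THE SMALL-FIELD CLASS: F224 `smallField_of_tanCritical_roadB_frameFree_end` with row NE3's (P♮)_W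
# hypothesis `hP` (+ `hCP`, `hregTA`) SUPPLIED by row NE3-R2's class theorem `NE3ClassRadiusFamily.classSlicePoincare_of_lines'` ∕ `CPLine_nonneg` and the orbit comparison's fifth k-free line
# (F225), at the class radius `x = ε∕(L^{j+1})²` — so (P_a) ([B9] Thm 3.11 SHAPE for OUR `softSymOpKa`) rests on NO displayed analytic letter: the END rests on the rows (C) of `cGreenSymKa`
# ([B9] Thm 3.3∕(3.49) SHAPE), the bootstrap line, and k-free NUMERIC lines of the class (file 157 of the curved (APE), F227)

Cell `pub-balaban`, rung (B)+1 sub-cell t4, lineage `b2b-balaban-t4-ne7-p1` (CRUX PROVER NE7 #1 = OWNER of row NE7), generation 86; memo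
`t4/b2b-balaban-t4-ne7-p1-g86/ORBIT-COMPARISON.md` §5.  Over F224 (END) and F225 `NE7SlicePoincareTAClass` (`cdivSq_le`), row NE3-R2's `NE3ClassRadiusFamily` BY NAME.
WHAT ([folklore]; 0 def, 0 sorry).  §1 `regTA_class` (F224's class line `hregTA` at `x = ε∕M²` from the fifth k-free line `hK5`, by `cdivSq_le`); §2 **`smallField_of_tanCritical_roadB_class_end`**:
F224 with `{CP} hCP hP hregTA` REPLACED by `hd3 : 3 ≤ d`, the class radius data `0 < ε ≤ θ`, `0 < εc`, row NE3-R2's two ε-lines `hε1 hε2` and four k-free lines `hK1–hK4`, the fifth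
line `hK5`, and `hxε : x = ε∕M²`; `CP := CPLine d L (card n) εc θ`; `hCTdef` at `C_T = 4·n·(1 + 4C_div²(x))·CPLine·M²` (k-uniform × `M²`: `C_div²(ε∕M²) ≤ n·d·(2+2(d−1)ε)²·(2·64^d)²`).
HONEST FRAMING (page 1): every (P_a)-side hypothesis of the END is now class data + k-free NUMERIC lines (row NE3's (P♮)_W is a THEOREM, consumed by name); the rows (C) of `cGreenSymKa`
are DISPLAYED, NOT proved (NE9 ∕ lit-balaban, the wall (ε)); (APE) on curved data NOT proved unconditionally; NOT ONE-STEP, NOT NE7; spine 0∕9; finite T⁴ rung (B)+1 — NOT infinite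
volume, NOT mass gap, NOT `BetaPertH`, NOT Clay.  Continuum YM on T⁴ ⇐ BetaPertH ∧ nine spine estimates (0/9 proved); BetaPertH ⇐ (D1) ∧ (D4) ∧ CAP+tail; G-an2-4 gates asym, D1 and
NE2/3/4.
-/

set_option autoImplicit false

open scoped BigOperators InnerProductSpace Matrix Matrix.Norms.L2Operator
open NormedSpace Finset

namespace Summit.QuantumFields.BalabanUV.T4Continuum.NE7ApeCurvedRepRoadBClassEnd

open Literature.MathematicalPhysics.QuantumFieldTheory.Balaban1983to89
open B7Prop1Explicit B7Prop2Explicit MatrixLog UnitaryModel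
open T4AveragingDeficitWall (Ad IsUnitaryCfg IsSkewDir SmallField vary curlAt dirL1 flux covGrad)
open T4AveragingDeficitWallBoundary (IsPeriodicCfg periodBox)
open AveragingDeficitPeriodicCounting (IsPeriodicDir)
open AveragingDeficitTwoLevelPrep (twoLevelSmall)
open AveragingDeficitMultiLevelPrep (cavgIter LevelSmall)
open MinimalActionLevels (perWin)
open BlockAverageVaryHolo (nbRad)
open BlockAveragePushDirGauge (gaugeDir)
open NE3HessForm (hess dAction)
open NE3TangentCovariantTower (dirIter QbarIter)
open NE3EnergyShapes (IsUnitarySite IsPeriodicSite)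
open NE3CovariantWeitzenbock (covDiv)
open NE3RightInverseSupLetters (frameC supC corrC)
open NE3QbarIterCovLiftPrep (cruxC)
open NE3RightInverseSolveLetters (thetaLoc)
open NE3HatInvCurlLetters (curl1C)
open BlockAverageVaryDisc (rho0)
open NE3LinearisedAverageSup (curvSum)
open NE3HilbertSchmidtTorus (Form extF)
open NE3.PairLandauB8 (IsLandauB8)
open NE7ApeCurvedRepRoadBScalarFreeEnd (smallField_of_tanCritical_roadB_scalarFree_end)
open NE7BalabanSliceSourceDuality (balabanSliceLetter_of_sourceLetter)
open NE7ConstrainedGreenIdentity (constrainedGreen)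
open NE7BalabanSoftOperator (skewForms qbarOpK)
open NE3QbarIterCovLiftPrep (cruxC)
open NE7BalabanSoftOperatorMass (softSymOpKa cGreenSymKa)
open NE7BalabanSoftOperator (skewSecs gradOpK landauProjK)
open NE3RightInverseSolveLetters (thetaLoc)
open NE3QbarIterCovLiftPrep (liftC)
open AveragingDeficitTwoLevelPrep (prop1Radius)
open SpreadLift (loopRad)
open T4AveragingDeficitWall (dirSq curlSq)
open NE3HilbertSchmidtTorus (Form extF)
open NE7LandauCorrection (softSymOpKa_posDef_of_slicePoincare)
open NE7ApeCurvedRepRoadBPositivityMassEnd (smallField_of_tanCritical_roadB_positivityMass_end)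
open NE7ApeCurvedRepRoadBSlicePoincareEnd (smallField_of_tanCritical_roadB_slicePoincare_end)
open NE7SlicePoincareTA (slicePoincare_TA_of_frameFree)
open NE7ApeCurvedRepRoadBFrameFreeEnd (CT_nonneg H1_of_frameFree smallField_of_tanCritical_roadB_frameFree_end)
open NE7SlicePoincareTAClass (cdivSq_le)
open NE3ClassRadiusFamily (classSlicePoincare_of_lines' CPLine_nonneg)
open NE3SlicePoincareBudgetLine (ShLine SmallYLine CPLine)
open NE3CovariantLineSumsL2 (C2sq)
open NE3CovariantLineSumsL2Tower (rho)
open MinimalActionRate (sfClass)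
open NE3FrameFreeSliceW (frameFreeBlockLandauW)
open NE3SlicePoincareShape (SlicePoincare)
open NE7SquaredBumpNestedMeanOperator (tentMean2)
open NE7ConstrainedGreenSymmetricMass (sourceLetter_of_posDef_rowsA)
open NE7TensionRadiusOfFluxGradient (abs_dAction_le_of_fluxGrad)

noncomputable section

variable {d : ℕ} {n : Type*} [Fintype n] [DecidableEq n]

/-! ## §1 F224's class line at `x = ε∕M²` from the fifth k-free line -/

omit [DecidableEq n] in
/-- **`hregTA` ON THE CLASS**: at `x = ε∕M²`, `2·ε_g·n·(2 + 2(1 + 4C_div²(x)))·CPLine·M² ≤ 1∕2` follows from the k-free line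
`32·n²·#Plane·ε²·(2 + 2(1 + 4·n·d·(2+2(d−1)ε)²·(2·64^d)²))·CPLine ≤ 1∕2` (`x²M⁴ = ε²`, `C_div²(ε∕M²) ≤ n·d·(2+2(d−1)ε)²(2·64^d)²`, `0 ≤ CPLine`). [folklore] -/
theorem regTA_class (hd3 : 3 ≤ d) {L : ℕ} (hL : 2 ≤ L) (j : ℕ) {ε θ εc : ℝ} (hε : 0 < ε) (hεθ : ε ≤ θ) (hεc : 0 < εc)
    (hK5 : 32 * (Fintype.card n : ℝ) ^ 2 * (Fintype.card (T4AveragingDeficitWall.Plane d)) * ε ^ 2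
      * (2 + 2 * (1 + 4 * ((Fintype.card n : ℝ) * d * (2 + 2 * (((d : ℝ) - 1) * ε)) ^ 2 * (2 * (64 : ℝ) ^ d) ^ 2))) * CPLine d L (Fintype.card n) εc θ ≤ 1 / 2)
    {x : ℝ} (hxε : x = ε / ((L : ℝ) ^ (j + 1)) ^ 2) :
    2 * (16 * Fintype.card n * (Fintype.card (T4AveragingDeficitWall.Plane d)) * x ^ 2 * ((L : ℝ) ^ (j + 1)) ^ 2) * (Fintype.card n : ℝ) * (2 + 2 * (1 + 4 * ((Fintype.card n : ℝ) * d * (2 + 2 * (((d : ℝ) - 1) * (((L : ℝ) ^ (j + 1)) - 1) * x) * (L : ℝ) ^ (j + 1)) ^ 2 * (2 / tentMean2 d (L ^ (j + 1))) ^ 2))) * (CPLine d L (Fintype.card n) εc θ) * ((L : ℝ) ^ (j + 1)) ^ 2 ≤ 1 / 2 := by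
  have hd1 : 1 ≤ d := by omega
  have hL0 : (0 : ℝ) < L := by exact_mod_cast (show 0 < L by omega)
  have hM0 : (0 : ℝ) < (L : ℝ) ^ (j + 1) := by positivity
  have hCP : 0 ≤ CPLine d L (Fintype.card n) εc θ := CPLine_nonneg hd1 (Nat.cast_nonneg _) hεc.le (hε.le.trans hεθ)
  have hAA : ((Fintype.card n : ℝ) * d * (2 + 2 * (((d : ℝ) - 1) * (((L : ℝ) ^ (j + 1)) - 1) * x) * (L : ℝ) ^ (j + 1)) ^ 2 * (2 / tentMean2 d (L ^ (j + 1))) ^ 2) ≤ (Fintype.card n : ℝ) * d * (2 + 2 * (((d : ℝ) - 1) * ε)) ^ 2 * (2 * (64 : ℝ) ^ d) ^ 2 := by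
    have h := cdivSq_le hd1 hL j (Fintype.card n) hε.le
    rw [← hxε] at h
    exact h
  have hx2 : x ^ 2 * ((L : ℝ) ^ (j + 1)) ^ 2 * ((L : ℝ) ^ (j + 1)) ^ 2 = ε ^ 2 := by
    rw [hxε]; field_simp
  have e : 2 * (16 * Fintype.card n * (Fintype.card (T4AveragingDeficitWall.Plane d)) * x ^ 2 * ((L : ℝ) ^ (j + 1)) ^ 2) * (Fintype.card n : ℝ) * (2 + 2 * (1 + 4 * ((Fintype.card n : ℝ) * d * (2 + 2 * (((d : ℝ) - 1) * (((L : ℝ) ^ (j + 1)) - 1) * x) * (L : ℝ) ^ (j + 1)) ^ 2 * (2 / tentMean2 d (L ^ (j + 1))) ^ 2))) * (CPLine d L (Fintype.card n) εc θ) * ((L : ℝ) ^ (j + 1)) ^ 2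
      = 32 * (Fintype.card n : ℝ) ^ 2 * (Fintype.card (T4AveragingDeficitWall.Plane d)) * (x ^ 2 * ((L : ℝ) ^ (j + 1)) ^ 2 * ((L : ℝ) ^ (j + 1)) ^ 2) * ((2 + 2 * (1 + 4 * ((Fintype.card n : ℝ) * d * (2 + 2 * (((d : ℝ) - 1) * (((L : ℝ) ^ (j + 1)) - 1) * x) * (L : ℝ) ^ (j + 1)) ^ 2 * (2 / tentMean2 d (L ^ (j + 1))) ^ 2))) * (CPLine d L (Fintype.card n) εc θ)) := by ring
  rw [e, hx2]
  have hmono : (2 + 2 * (1 + 4 * ((Fintype.card n : ℝ) * d * (2 + 2 * (((d : ℝ) - 1) * (((L : ℝ) ^ (j + 1)) - 1) * x) * (L : ℝ) ^ (j + 1)) ^ 2 * (2 / tentMean2 d (L ^ (j + 1))) ^ 2))) * (CPLine d L (Fintype.card n) εc θ) ≤ (2 + 2 * (1 + 4 * ((Fintype.card n : ℝ) * d * (2 + 2 * (((d : ℝ) - 1) * ε)) ^ 2 * (2 * (64 : ℝ) ^ d) ^ 2))) * (CPLine d L (Fintype.card n) εc θ) := mul_le_mul_of_nonneg_right (by linarith)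 hCP
  have hK0 : 0 ≤ 32 * (Fintype.card n : ℝ) ^ 2 * (Fintype.card (T4AveragingDeficitWall.Plane d)) * ε ^ 2 := by positivity
  calc 32 * (Fintype.card n : ℝ) ^ 2 * (Fintype.card (T4AveragingDeficitWall.Plane d)) * ε ^ 2 * ((2 + 2 * (1 + 4 * ((Fintype.card n : ℝ) * d * (2 + 2 * (((d : ℝ) - 1) * (((L : ℝ) ^ (j + 1)) - 1) * x) * (L : ℝ) ^ (j + 1)) ^ 2 * (2 / tentMean2 d (L ^ (j + 1))) ^ 2))) * (CPLine d L (Fintype.card n) εc θ))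
      ≤ 32 * (Fintype.card n : ℝ) ^ 2 * (Fintype.card (T4AveragingDeficitWall.Plane d)) * ε ^ 2 * ((2 + 2 * (1 + 4 * ((Fintype.card n : ℝ) * d * (2 + 2 * (((d : ℝ) - 1) * ε)) ^ 2 * (2 * (64 : ℝ) ^ d) ^ 2))) * (CPLine d L (Fintype.card n) εc θ)) := mul_le_mul_of_nonneg_left hmono hK0
    _ ≤ 1 / 2 := by linarith [hK5]

/-! ## §2 The END on the class -/

set_option maxHeartbeats 800000 in
-- the END's statement elaborates at ≈ 200k heartbeats (F204∕F218∕F224); budget set explicitly, proof is one application of F224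
/-- **THE CURVED (APE) ON THE SMALL-FIELD CLASS, RESTING ON (C) + THE BOOTSTRAP LINE + NUMERIC LINES**: F224 with row NE3's (P♮)_W and the orbit comparison's class line supplied from
class data at `x = ε∕M²`. [folklore] -/
theorem smallField_of_tanCritical_roadB_class_end [Nonempty n] (hd : 2 ≤ d) {L N : ℕ} [NeZero N] (hL : 2 ≤ L) (j : ℕ)
    -- the background
    {W : Site d → Fin d → (Matrix n n ℂ)ˣ} {x : ℝ} (hWu : IsUnitaryCfg W) (hWP : IsPeriodicCfg W ((N * L ^ (j + 1) : ℕ) : ℤ))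
    (hx : 0 ≤ x) (hs : LevelSmall d L j x) (hWx : SmallField W x)
    -- the sup radius of the representative and the regime at `x′ = x + 4(e^{α₀} − 1)`
    {α₀ : ℝ} (hα0 : 0 ≤ α₀) (hs' : LevelSmall d L j (x + 4 * (Real.exp α₀ - 1)))
    (hθ : cruxC d L * (((L : ℝ) ^ (j + 1)) ^ 2 * (x + 4 * (Real.exp α₀ - 1))) < 1)
    (hθl : thetaLoc d L * (((L : ℝ) ^ (j + 1)) ^ 2 * (x + 4 * (Real.exp α₀ - 1))) < 1)
    (hε : ((L : ℝ) ^ (j + 1)) ^ 2 * (x + 4 * (Real.exp α₀ - 1)) ≤ 1)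
    -- the field: of the class, tangent-critical, over `W`'s datum
    {U : Site d → Fin d → (Matrix n n ℂ)ˣ} (hUu : IsUnitaryCfg U) (hUP : IsPeriodicCfg U ((N * L ^ (j + 1) : ℕ) : ℤ))
    {xU : ℝ} (hxU : 0 ≤ xU) (hsU : LevelSmall d L j xU) (hUxU : SmallField U xU)
    (hcritU : ∀ Y : Site d → Fin d → Matrix n n ℂ, IsSkewDir Y → IsPeriodicDir Y ((N * L ^ (j + 1) : ℕ) : ℤ) →
      dirIter L (j + 1) U Y = 0 → dAction U Y (perWin d (N * L ^ (j + 1))) = 0)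
    (hTopUW : cavgIter L (j + 1) U = cavgIter L (j + 1) W)
    -- row NE3's class data of `W` and E′'s initial gauge ∕ regime (as in `exists_landauRep_W`), the constant `c_RE` named; road (B)'s two extra regime lines
    -- the FLUX-GRADIENT radii of `W` and `U` (row NE3's `RegularSup` datum; (1.8)∕(1.9) TYPE via `NE3FluxGradientDictionary` ∕ `MinimalActionClassSix`)
    {gW gU : ℝ} (hgW : ∀ (z : Site d) (μ : Fin d) (π : T4AveragingDeficitWall.Plane d), ‖T4AveragingDeficitWall.covGrad W (T4AveragingDeficitWall.flux W) z μ π‖ ≤ gW)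
    (hgU : ∀ (z : Site d) (μ : Fin d) (π : T4AveragingDeficitWall.Plane d), ‖T4AveragingDeficitWall.covGrad U (T4AveragingDeficitWall.flux U) z μ π‖ ≤ gU)
    (hbx : 23040 * (d : ℝ) ^ 4 * (frameC d L + d) ^ 2 * ((L : ℝ) ^ (j + 1)) ^ 2 * x ≤ 1)
    (hcx : 11520 * (d : ℝ) ^ 4 * (frameC d L + d) ^ 3 * ((L : ℝ) ^ (j + 1)) ^ 3 * (2 * gW) ≤ 1)
    (hbx' : 256 * (d : ℝ) ^ 2 * ((L : ℝ) ^ (j + 1)) ^ 2 * x ≤ 1) (hcx' : 16 * (d : ℝ) * ((L : ℝ) ^ (j + 1)) ^ 3 * (2 * gW) ≤ 1)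
    {r₀ b₀ : ℝ} (hr₀ : ∀ (y : Site d) (μ : Fin d), ‖(((W y μ)⁻¹ * U y μ : (Matrix n n ℂ)ˣ) : (Matrix n n ℂ)) - 1‖ ≤ r₀)
    (hb₀ : ∀ x : Site d, ‖covDiv W (fun y μ => mlog (((W y μ)⁻¹ * U y μ : (Matrix n n ℂ)ˣ) : (Matrix n n ℂ))) x‖ ≤ b₀)
    {cRE : ℝ} (hcRE : cRE = 1 + 2 * (Fintype.card n : ℝ) * (64 * (d : ℝ) ^ 2 * N) ^ d + 27 * (Fintype.card n : ℝ) ^ 3 * (512 : ℝ) ^ d * (N : ℝ) ^ d)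
    (hreg₁ : (36 * (d : ℝ) * (frameC d L + d) ^ 2) * ((L : ℝ) ^ (j + 1)) ^ 2 * (cRE * b₀) ≤ 1 / 10)
    (hreg₂ : (36 * (d : ℝ) * (frameC d L + d)) * (L : ℝ) ^ (j + 1) * (cRE * b₀) ≤ 1 / 25)
    (hreg₃ : r₀ + 5 / 2 * ((36 * (d : ℝ) * (frameC d L + d)) * (L : ℝ) ^ (j + 1) * (cRE * b₀)) ≤ 1 / 20)
    (hline : cRE * (4 * ((36 * (d : ℝ) * (frameC d L + d) ^ 2) * ((L : ℝ) ^ (j + 1)) ^ 2) * (b₀ + 4 * (cRE * b₀))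
        + 25 * d * (r₀ + 5 / 2 * ((36 * (d : ℝ) * (frameC d L + d)) * (L : ℝ) ^ (j + 1) * (cRE * b₀))) * ((36 * (d : ℝ) * (frameC d L + d)) * (L : ℝ) ^ (j + 1))
        + 14 * d * ((36 * (d : ℝ) * (frameC d L + d)) * (L : ℝ) ^ (j + 1)) ^ 2 * (cRE * b₀)) ≤ 1 / 2)
    -- E′'s radii named: `α_E`, `θ_u`; the tent extension's `δ = corrC∕M·2θ_u`; road (B)'s regime `α_E ≤ 1∕40`, `θ_u ≤ 1∕160`, `δ ≤ 1∕40`, `α₀ ≥ α_E + δ + 4(2θ_u+δ)(α_E+δ)`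
    {αE θu : ℝ} (hαE : αE = 2 * (r₀ + 5 / 2 * ((36 * (d : ℝ) * (frameC d L + d)) * (L : ℝ) ^ (j + 1) * (cRE * b₀))))
    (hθu : θu = 4 * ((36 * (d : ℝ) * (frameC d L + d) ^ 2) * ((L : ℝ) ^ (j + 1)) ^ 2 * (cRE * b₀)))
    (hαE40 : αE ≤ 1 / 40) (hθu160 : θu ≤ 1 / 160)
    {δ : ℝ} (hδ : δ = corrC d / (L : ℝ) ^ (j + 1) * (2 * θu)) (hδ40 : δ ≤ 1 / 40) (hα₀ : αE + δ + 4 * (2 * θu + δ) * (αE + δ) ≤ α₀)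
    -- the remaining analytic letters at `W`: (L1)′ and α₁ for the SAME-TOP structured fields of radius `α₀`, (L2), (L3) discharged
    -- (L1)′ DISCHARGED (F111): the quadratic-remainder regime, the slice `S` containing the `W`-tangent skew periodic fields, and the names `c_N = 4m`, `ν = 24·#Plane·m`
    (hs1 : LevelSmall d L (j + 1) x) (hA : curvSum d L (j + 1) x ≤ 2 / 3 * L) (hσ0 : 4 * (3 + 12 * (d : ℝ)) ^ 2 * (L : ℝ) ^ (j + 1) * α₀ ≤ rho0 d L ^ 2)
    {cN aN ν : ℝ}
    (haN : aN = (supC d L / ((L : ℝ) ^ (j + 1) * (1 - cruxC d L * (((L : ℝ) ^ (j + 1)) ^ 2 * x)))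
        * (4 * (3 + 12 * (d : ℝ)) ^ 3 / rho0 d L ^ 2 * ((L : ℝ) ^ (j + 1) * α₀) ^ 2)))
    (hcN : cN = 4 * (supC d L / ((L : ℝ) ^ (j + 1) * (1 - cruxC d L * (((L : ℝ) ^ (j + 1)) ^ 2 * x)))
        * (4 * (3 + 12 * (d : ℝ)) ^ 3 / rho0 d L ^ 2 * ((L : ℝ) ^ (j + 1) * α₀) ^ 2)))
    (hνm : ν = 24 * (Fintype.card (T4AveragingDeficitWall.Plane d) : ℝ) * (supC d L / ((L : ℝ) ^ (j + 1) * (1 - cruxC d L * (((L : ℝ) ^ (j + 1)) ^ 2 * x)))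
        * (4 * (3 + 12 * (d : ℝ)) ^ 3 / rho0 d L ^ 2 * ((L : ℝ) ^ (j + 1) * α₀) ^ 2)))
    -- `x ≤ 1/4` (F141's regime; implied by `hbx'` when `d ≥ 2`, kept displayed for a one-line discharge)
    (hx4 : x ≤ 1 / 4)
    -- ONE MORE displayed regime line at `x` itself (implied by `hθ` at `x′ ≥ x`; kept displayed for a one-line discharge): the surjectivity of `Qbar` (row NE3's right inverse)
    [hPfine : NeZero (N * L ^ (j + 1))]
    (hθx : cruxC d L * (((L : ℝ) ^ (j + 1)) ^ 2 * x) < 1)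
    -- print's mass coefficient `a` ([B9] (3.26) «a(L^jη)^{−2}Q*Q»; in the tree's unweighted unit-lattice sums print's choice reads `a·M^{d−4}`, F202) — a PARAMETER
    (a : ℝ)
    -- TWO MORE displayed regime lines at `x`: row NE3's right-inverse ℓ²-letter (lift piece F214) and its gauge Poincaré regime (F213)
    (hθlx : thetaLoc d L * (((L : ℝ) ^ (j + 1)) ^ 2 * x) < 1)
    (hsmallG : 8 * d * (((L : ℝ) ^ (j + 1)) * (((d : ℝ) - 1) * (((L : ℝ) ^ (j + 1)) - 1) * x)) ^ 2
      + 2 * (Fintype.card n * (4 * (d : ℝ) ^ 2 * ((L : ℝ) ^ (j + 1) - 1) ^ 2 * x + 16 * d * loopRad d L ((prop1Radius d L)^[j] x)) ^ 2) ≤ 1 / 2)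
    -- ROW NE3-R2's CLASS DATA ((P♮)_W is row NE3's THEOREM on `sfClass d L N ε (j+1)`, `NE3ClassRadiusFamily.classSlicePoincare_of_lines'`): `3 ≤ d`, class radius `0 < ε ≤ θ`,
    -- K1 cut `εc > 0`, the two ε-lines and the four k-free numeric lines of row NE3-R2; the orbit comparison's fifth k-free line (F225); and `x` IS the class radius at level `j+1`
    (hd3 : 3 ≤ d) {ε θ εc : ℝ} (hεpos : 0 < ε) (hεθ : ε ≤ θ) (hεc : 0 < εc)
    (hε1 : 16 * (14464 * ((d : ℝ) + 1) ^ 2 * ((d : ℝ) + 4) ^ 2) * ε ≤ 3)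
    (hε2 : 2 * twoLevelSmall d L * ε ≤ (L : ℝ) ^ 2)
    (hK1 : ShLine d L (Fintype.card n) εc θ ≤ 1 / 2) (hK2 : SmallYLine d L (Fintype.card n) εc θ ≤ 1 / 2)
    (hK3 : 68 / 3 * (((d : ℝ) + 1) * ((d : ℝ) + 4)) * C2sq d L * θ ≤ rho d L / 2)
    (hK4 : 8 * d * (((d : ℝ) - 1) * θ) ^ 2
      + 2 * ((Fintype.card n : ℝ) * ((4 * (d : ℝ) ^ 2 + 272 * d * (((d : ℝ) + 1) * ((d : ℝ) + 4))) * θ) ^ 2) ≤ 1 / 2)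
    (hK5 : 32 * (Fintype.card n : ℝ) ^ 2 * (Fintype.card (T4AveragingDeficitWall.Plane d)) * ε ^ 2
      * (2 + 2 * (1 + 4 * ((Fintype.card n : ℝ) * d * (2 + 2 * (((d : ℝ) - 1) * ε)) ^ 2 * (2 * (64 : ℝ) ^ d) ^ 2))) * CPLine d L (Fintype.card n) εc θ ≤ 1 / 2)
    (hxε : x = ε / ((L : ℝ) ^ (j + 1)) ^ 2)
    -- the constant of (H1) NAMED: `C_T = 4·n·(1 + 4C_div²)·CPLine·M²` (k-uniform × M² at `x = ε∕M²`, F225 `cdivSq_le`)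
    {CT : ℝ} (hCTdef : CT = (4 * (Fintype.card n : ℝ) * (1 + 4 * ((Fintype.card n : ℝ) * d * (2 + 2 * (((d : ℝ) - 1) * (((L : ℝ) ^ (j + 1)) - 1) * x) * (L : ℝ) ^ (j + 1)) ^ 2 * (2 / tentMean2 d (L ^ (j + 1))) ^ 2)) * (CPLine d L (Fintype.card n) εc θ) * ((L : ℝ) ^ (j + 1)) ^ 2))
    -- F212's Gårding regime for the mass `a` and the plaquette radius `x` (the class line `x·M²` small, constants of F215–F217)
    (hregP1 : 28 * d * x * (9 * CT * (Fintype.card n : ℝ) + 2 * (4 * Fintype.card n * ((L : ℝ) ^ (j + 1)) ^ 2) * (9 * CT * (16 * Fintype.card n * (Fintype.card (T4AveragingDeficitWall.Plane d)) * x ^ 2 * ((L : ℝ) ^ (j + 1)) ^ 2) + 3)) < 1)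
    (hregP2 : 28 * d * x * ((2 * (4 * Fintype.card n * ((L : ℝ) ^ (j + 1)) ^ 2) * (4 * (d : ℝ)) * (9 * CT * (16 * Fintype.card n * (Fintype.card (T4AveragingDeficitWall.Plane d)) * x ^ 2 * ((L : ℝ) ^ (j + 1)) ^ 2) + 3) + 144 * (d : ℝ) * CT + 3) * (Fintype.card n * ((liftC d / (1 - thetaLoc d L * (((L : ℝ) ^ (j + 1)) ^ 2 * x))) ^ 2 * (((L : ℝ) ^ (j + 1)) ^ d / ((L : ℝ) ^ (j + 1)) ^ 2)))) < a)
    -- Bałaban's constrained propagator `C_a(W) = G_a − G_aQb*(QbG_aQb*)⁻¹QbG_a` (F202's `cGreenSymKa`, a NAMED operator under (P_a), here supplied by F217 ∘ F223 from row NE3's (P♮)_W), named by a defining equation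
    {C : skewForms d n (N * L ^ (j + 1)) →ₗ[ℝ] skewForms d n (N * L ^ (j + 1))}
    (hCdef : C = cGreenSymKa (N := N) (one_le_two.trans hL) j hWu hx hs hWx hWP hL hθx a
      (softSymOpKa_posDef_of_slicePoincare (N := N) (one_le_two.trans hL) hL j hWu hWP hx hs hWx hθx hθlx (le_trans one_le_two hd) hx hWx hsmallG
        (CT_nonneg (d := d) (n := n) j x (CPLine_nonneg (L := L) (le_trans (by norm_num) hd3) (Nat.cast_nonneg (Fintype.card n)) hεc.le (hεpos.le.trans hεθ)) hCTdef)
        (H1_of_frameFree (N := N) hd hL j hWu hWP hx hs hWx hsmallG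
          (CPLine_nonneg (L := L) (le_trans (by norm_num) hd3) (Nat.cast_nonneg (Fintype.card n)) hεc.le (hεpos.le.trans hεθ))
          (classSlicePoincare_of_lines' hd3 hL (Nat.one_le_iff_ne_zero.mpr (NeZero.ne N)) hεpos hεθ hεc hε1 hε2 hK1 hK2 hK3 hK4 j W ⟨hWu, hWP, hxε ▸ hWx⟩)
          (regTA_class (d := d) (n := n) hd3 hL j hεpos hεθ hεc hK5 hxε) hCTdef) hregP1 hregP2))
    -- [B9] Thm 3.3 (3.42)₁,₂∕(3.49) SHAPE (DISPLAYED, NOT proved): the sup-VALUE row `K₀` and the sup-CURL row `K` of `C_a(W)`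
    {K₀ K : ℝ} (hK : 0 ≤ K)
    (hC0 : ∀ h : skewForms d n (N * L ^ (j + 1)), ∀ g : ℝ, (∀ (y : Site d) (κ : Fin d), ‖extF (N * L ^ (j + 1)) (h : Form d n (N * L ^ (j + 1))) y κ‖ ≤ g) →
      ∀ (y : Site d) (κ : Fin d), ‖extF (N * L ^ (j + 1)) ((C h : skewForms d n (N * L ^ (j + 1))) : Form d n (N * L ^ (j + 1))) y κ‖ ≤ K₀ * g)
    (hC1 : ∀ h : skewForms d n (N * L ^ (j + 1)), ∀ g : ℝ, (∀ (y : Site d) (κ : Fin d), ‖extF (N * L ^ (j + 1)) (h : Form d n (N * L ^ (j + 1))) y κ‖ ≤ g) →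
      ∀ (z : Site d) (μ' ν' : Fin d), μ' ≠ ν' →
        ‖curlAt W (extF (N * L ^ (j + 1)) ((C h : skewForms d n (N * L ^ (j + 1))) : Form d n (N * L ^ (j + 1)))) z μ' ν'‖ ≤ K * g)
    -- the bootstrap's class-smallness: `2·card n·τ_W·K₀ ≤ 1` with the DISCHARGED tension radius `τ_W = d·g_W + 12·#Plane·x²` (`NE7TensionRadiusOfFluxGradient`)
    (hsmall : 2 * (Fintype.card n * ((d : ℝ) * gW + 12 * (Fintype.card (T4AveragingDeficitWall.Plane d) : ℝ) * x ^ 2)) * K₀ ≤ 1)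
    -- the END's constant `K_B` NAMED: `K_B = card n · 2K`
    {KB : ℝ} (hKB : KB = Fintype.card n * (2 * K))
    -- (T1♯)'s constants NAMED (F187): `C_a = 2·64^d`, `C_a′ = K_Δ(2g_W)·2·64^d`
    {Ca Ca' : ℝ} (hCa : Ca = 2 * (64 : ℝ) ^ d)
    (hCa' : Ca' = ((35 * (d : ℝ) / ((L : ℝ) ^ (j + 1)) ^ 2 + 2 * (2 * (d : ℝ) ^ 2 * ((L : ℝ) ^ (j + 1) - 1) * (2 * gW) + 8 * (d : ℝ) ^ 3 * ((L : ℝ) ^ (j + 1) - 1) ^ 2 * x ^ 2) + 4 * (d : ℝ) * (((d : ℝ) - 1) * ((L : ℝ) ^ (j + 1) - 1) * x) ^ 2 + 8 * (d : ℝ) * (((d : ℝ) - 1) * ((L : ℝ) ^ (j + 1) - 1) * x) / (L : ℝ) ^ (j + 1)) * (2 * (64 : ℝ) ^ d)))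
    (hcritW : ∀ Y : Site d → Fin d → Matrix n n ℂ, IsSkewDir Y → IsPeriodicDir Y ((N * L ^ (j + 1) : ℕ) : ℤ) → dirIter L (j + 1) W Y = 0 →
      dAction W Y (perWin d (N * L ^ (j + 1))) = 0) :
    SmallField U (x + ((KB * (1 + 2 * d * (2 * ((d : ℝ) * L) * Real.exp (((L : ℝ) ^ d / L) * ((d : ℝ) * (16 * ((d : ℝ) + 1) * ((d : ℝ) + 4) * (L : ℝ) ^ 2) * (1250 * ((nbRad d L : ℝ) + L) + 8 * ((d : ℝ) * L) + 2 * L)) * (2 / twoLevelSmall d L))))) * (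
        ((x + 4 * (Real.exp α₀ - 1))
            * ((curl1C d L / (1 - thetaLoc d L * (((L : ℝ) ^ (j + 1)) ^ 2 * (x + 4 * (Real.exp α₀ - 1)))))
                * (((L : ℝ) ^ (j + 1)) ^ d / ((L : ℝ) ^ (j + 1)) ^ 2))
            * (Real.exp (((L : ℝ) ^ d / L) * ((d : ℝ) * (16 * ((d : ℝ) + 1) * ((d : ℝ) + 4) * (L : ℝ) ^ 2)
                  * (1250 * ((nbRad d L : ℝ) + L) + 8 * ((d : ℝ) * L) + 2 * L)) * (2 / twoLevelSmall d L))
                * ((L : ℝ) / (L : ℝ) ^ d) ^ j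
                * (((d : ℝ) * (2 * nbRad d L + 1) ^ d) * ((2 * (d : ℝ) + 4) * (L : ℝ) ^ 2) * (2 * (L : ℝ) ^ j) * (Real.exp α₀ - 1)
                  + (17 / 8 * ((L : ℝ) ^ 2) ^ j * (x + 4 * (Real.exp α₀ - 1)))
                    * (((d : ℝ) * (2 * nbRad d L + 1) ^ d) * ((2 * (d : ℝ) + 4)
                          * (2 * (2 * L * (nbRad d L : ℝ) + 128 * ((d : ℝ) + 1) * ((d : ℝ) + 4) * (L : ℝ) ^ 2)))
                      + ((d : ℝ) * (2 * nbRad d L + 1) ^ d) * ((2 * (d : ℝ) + 4) * (L : ℝ) ^ 2 * (2 * (nbRad d L : ℝ))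
                          + 2 * (8 * (L : ℝ) + (1250 * ((nbRad d L : ℝ) + L) + 8 * (d * L) + 2 * L))
                              * (16 * ((d : ℝ) + 1) * ((d : ℝ) + 4) * (L : ℝ) ^ 2))))))
        + (Fintype.card (T4AveragingDeficitWall.Plane d) : ℝ)
          * (2 * (240 * (Real.exp α₀ - 1) * α₀ * (2 * ((4 * ((d : ℝ) * αE / ((L ^ (j + 1) : ℕ) : ℝ) + ((L ^ (j + 1) : ℕ) : ℝ) * ((((d : ℝ) - 1) * (2 * gU) + ((d : ℝ) - 1) * (2 * gW) + d * (2 * (Real.exp αE - 1) * xU + 2 * (xU * x) + 2 * (x * (2 + x) * x) + 2 * (xU * (2 + xU) * xU))) + 2 * (b₀ + 3 * (cRE * b₀)))) + (4 * ((L ^ (j + 1) : ℕ) : ℝ) * (8 * d * (Real.exp (4 * αE) - 1) * x + 10 * d * x + 2 * (2 * (d : ℝ) ^ 2 * (((L ^ (j + 1) : ℕ) : ℝ) + 1) * (2 * gW) + 8 * (d : ℝ) ^ 3 * (((L ^ (j + 1) : ℕ) : ℝ) + 1) ^ 2 * x ^ 2) + 12 * d * (2 * (d : ℝ) * (((L ^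 (j + 1) : ℕ) : ℝ) + 1) * x) ^ 2) + 4 * (2 * (d : ℝ) * (((L ^ (j + 1) : ℕ) : ℝ) + 1) * x)) * αE + 2 * x * αE) + 2 * δ + 2 * (4 * (2 * θu + δ) * (αE + δ))) + 24 * α₀ * (Real.exp α₀ - 1) + x) + 8 * α₀ * (2 * ((4 * ((d : ℝ) * αE / ((L ^ (j + 1) : ℕ) : ℝ) + ((L ^ (j + 1) : ℕ) : ℝ) * ((((d : ℝ) - 1) * (2 * gU) + ((d : ℝ) - 1) * (2 * gW) + d * (2 * (Real.exp αE - 1) * xU + 2 * (xU * x) + 2 * (x * (2 + x) * x) + 2 * (xU * (2 + xU) * xU))) + 2 * (b₀ + 3 * (cRE * b₀)))) + (4 * ((L ^ (j + 1) : ℕ) : ℝ) * (8 * d * (Real.exp (4 * αE) - 1) * x + 10 * d * x + 2 * (2 * (d : ℝ) ^ 2 * (((L ^ (j + 1) : ℕ) : ℝ) + 1) * (2 * gW) + 8 * (d : ℝ) ^ 3 * (((L ^ (j + 1) : ℕ) : ℝ) + 1) ^ 2 * x ^ 2) + 12 * d * (2 * (d : ℝ) * (((L ^ (j + 1) : ℕ)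 : ℝ) + 1) * x) ^ 2) + 4 * (2 * (d : ℝ) * (((L ^ (j + 1) : ℕ) : ℝ) + 1) * x)) * αE + 2 * x * αE) + 2 * δ + 2 * (4 * (2 * θu + δ) * (αE + δ))) + 24 * α₀ * (Real.exp α₀ - 1))
              + 6 * (Real.exp α₀ - 1) * (2 * ((4 * ((d : ℝ) * αE / ((L ^ (j + 1) : ℕ) : ℝ) + ((L ^ (j + 1) : ℕ) : ℝ) * ((((d : ℝ) - 1) * (2 * gU) + ((d : ℝ) - 1) * (2 * gW) + d * (2 * (Real.exp αE - 1) * xU + 2 * (xU * x) + 2 * (x * (2 + x) * x) + 2 * (xU * (2 + xU) * xU))) + 2 * (b₀ + 3 * (cRE * b₀)))) + (4 * ((L ^ (j + 1) : ℕ) : ℝ) * (8 * d * (Real.exp (4 * αE) - 1) * x + 10 * d * x + 2 * (2 * (d : ℝ) ^ 2 * (((L ^ (j + 1) : ℕ) : ℝ) + 1) * (2 * gW) + 8 * (d : ℝ) ^ 3 * (((L ^ (j + 1) : ℕ) : ℝ) + 1) ^ 2 * x ^ 2) + 12 * d * (2 * (d : ℝ) * (((L ^ (j + 1) : ℕ)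 : ℝ) + 1) * x) ^ 2) + 4 * (2 * (d : ℝ) * (((L ^ (j + 1) : ℕ) : ℝ) + 1) * x)) * αE + 2 * x * αE) + 2 * δ + 2 * (4 * (2 * θu + δ) * (αE + δ))) + 24 * (Real.exp α₀ - 1) * α₀)
              + (2 * ((4 * ((d : ℝ) * αE / ((L ^ (j + 1) : ℕ) : ℝ) + ((L ^ (j + 1) : ℕ) : ℝ) * ((((d : ℝ) - 1) * (2 * gU) + ((d : ℝ) - 1) * (2 * gW) + d * (2 * (Real.exp αE - 1) * xU + 2 * (xU * x) + 2 * (x * (2 + x) * x) + 2 * (xU * (2 + xU) * xU))) + 2 * (b₀ + 3 * (cRE * b₀)))) + (4 * ((L ^ (j + 1) : ℕ) : ℝ) * (8 * d * (Real.exp (4 * αE) - 1) * x + 10 * d * x + 2 * (2 * (d : ℝ) ^ 2 * (((L ^ (j + 1) : ℕ) : ℝ) + 1) * (2 * gW) + 8 * (d : ℝ) ^ 3 * (((L ^ (j + 1) : ℕ) : ℝ) + 1) ^ 2 * x ^ 2) + 12 * d * (2 * (d : ℝ) * (((L ^ (j + 1) : ℕ) : ℝ) + 1) * x) ^ 2)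 + 4 * (2 * (d : ℝ) * (((L ^ (j + 1) : ℕ) : ℝ) + 1) * x)) * αE + 2 * x * αE) + 2 * δ + 2 * (4 * (2 * θu + δ) * (αE + δ))) + 24 * (Real.exp α₀ - 1) * α₀) * (2 * ((4 * ((d : ℝ) * αE / ((L ^ (j + 1) : ℕ) : ℝ) + ((L ^ (j + 1) : ℕ) : ℝ) * ((((d : ℝ) - 1) * (2 * gU) + ((d : ℝ) - 1) * (2 * gW) + d * (2 * (Real.exp αE - 1) * xU + 2 * (xU * x) + 2 * (x * (2 + x) * x) + 2 * (xU * (2 + xU) * xU))) + 2 * (b₀ + 3 * (cRE * b₀)))) + (4 * ((L ^ (j + 1) : ℕ) : ℝ) * (8 * d * (Real.exp (4 * αE) - 1) * x + 10 * d * x + 2 * (2 * (d : ℝ) ^ 2 * (((L ^ (j + 1) : ℕ) : ℝ) + 1) * (2 * gW) + 8 * (d : ℝ) ^ 3 * (((L ^ (j + 1) : ℕ) : ℝ) + 1) ^ 2 * x ^ 2) + 12 * d * (2 * (d : ℝ) * (((L ^ (j + 1) : ℕ) : ℝ) + 1) * x) ^ 2) + 4 * (2 * (d : ℝ) * (((L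 ^ (j + 1) : ℕ) : ℝ) + 1) * x)) * αE + 2 * x * αE) + 2 * δ + 2 * (4 * (2 * θu + δ) * (αE + δ))) + 24 * α₀ * (Real.exp α₀ - 1))
              + 960 * (Real.exp α₀ - 1) * α₀ ^ 2 + 32 * x * α₀ ^ 2)
            + (64 * α₀ * ((4 * ((d : ℝ) * αE / ((L ^ (j + 1) : ℕ) : ℝ) + ((L ^ (j + 1) : ℕ) : ℝ) * ((((d : ℝ) - 1) * (2 * gU) + ((d : ℝ) - 1) * (2 * gW) + d * (2 * (Real.exp αE - 1) * xU + 2 * (xU * x) + 2 * (x * (2 + x) * x) + 2 * (xU * (2 + xU) * xU))) + 2 * (b₀ + 3 * (cRE * b₀)))) + (4 * ((L ^ (j + 1) : ℕ) : ℝ) * (8 * d * (Real.exp (4 * αE) - 1) * x + 10 * d * x + 2 * (2 * (d : ℝ) ^ 2 * (((L ^ (j + 1) : ℕ) : ℝ) + 1) * (2 * gW) + 8 * (d : ℝ) ^ 3 * (((L ^ (j + 1) : ℕ) : ℝ) + 1) ^ 2 * x ^ 2) + 12 * d * (2 * (d : ℝ) * (((L ^ (j + 1) : ℕ) : ℝ)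 + 1) * x) ^ 2) + 4 * (2 * (d : ℝ) * (((L ^ (j + 1) : ℕ) : ℝ) + 1) * x)) * αE + 2 * x * αE) + 2 * δ + 2 * (4 * (2 * θu + δ) * (αE + δ))) + 1024 * x * α₀ ^ 2))
        + ν) + (2 * d * KB * (2 * ((d : ℝ) * L) * Real.exp (((L : ℝ) ^ d / L) * ((d : ℝ) * (16 * ((d : ℝ) + 1) * ((d : ℝ) + 4) * (L : ℝ) ^ 2) * (1250 * ((nbRad d L : ℝ) + L) + 8 * ((d : ℝ) * L) + 2 * L)) * (2 / twoLevelSmall d L))) * ((d : ℝ) * gW + 12 * (Fintype.card (T4AveragingDeficitWall.Plane d) : ℝ) * x ^ 2)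
              + (2 * KB * ((d : ℝ) * gW + 12 * (Fintype.card (T4AveragingDeficitWall.Plane d) : ℝ) * x ^ 2) * (1 + 4 * d * (2 * ((d : ℝ) * L) * Real.exp (((L : ℝ) ^ d / L) * ((d : ℝ) * (16 * ((d : ℝ) + 1) * ((d : ℝ) + 4) * (L : ℝ) ^ 2) * (1250 * ((nbRad d L : ℝ) + L) + 8 * ((d : ℝ) * L) + 2 * L)) * (2 / twoLevelSmall d L)))) + 2 * x) * ((Ca + (36 * d * (frameC d L + d) ^ 2 * ((L : ℝ) ^ (j + 1)) ^ 2 * cRE) * Ca') * (6 * (d : ℝ) * (L : ℝ) ^ (j + 1)))) * (α₀ + aN)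
        + ((2 * KB * ((d : ℝ) * gW + 12 * (Fintype.card (T4AveragingDeficitWall.Plane d) : ℝ) * x ^ 2) * (1 + 4 * d * (2 * ((d : ℝ) * L) * Real.exp (((L : ℝ) ^ d / L) * ((d : ℝ) * (16 * ((d : ℝ) + 1) * ((d : ℝ) + 4) * (L : ℝ) ^ 2) * (1250 * ((nbRad d L : ℝ) + L) + 8 * ((d : ℝ) * L) + 2 * L)) * (2 / twoLevelSmall d L)))) + 2 * x) * (36 * d * (frameC d L + d) ^ 2 * ((L : ℝ) ^ (j + 1)) ^ 2 * cRE)) * (2 * (d : ℝ) * (4 * (2 * θu + δ) * (αE + δ)) + (b₀ + 3 * (cRE * b₀)) + 2 * (d : ℝ) * aN) 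
        + ((2 * KB * ((d : ℝ) * gW + 12 * (Fintype.card (T4AveragingDeficitWall.Plane d) : ℝ) * x ^ 2) * (1 + 4 * d * (2 * ((d : ℝ) * L) * Real.exp (((L : ℝ) ^ d / L) * ((d : ℝ) * (16 * ((d : ℝ) + 1) * ((d : ℝ) + 4) * (L : ℝ) ^ 2) * (1250 * ((nbRad d L : ℝ) + L) + 8 * ((d : ℝ) * L) + 2 * L)) * (2 / twoLevelSmall d L)))) + 2 * x) * (1 + (Ca + (36 * d * (frameC d L + d) ^ 2 * ((L : ℝ) ^ (j + 1)) ^ 2 * cRE) * Ca'))) * (2 * θu) + cN + 28 * α₀ ^ 2)) :=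
  smallField_of_tanCritical_roadB_frameFree_end hd hL j hWu hWP hx hs hWx hα0 hs' hθ hθl hε hUu hUP hxU hsU hUxU hcritU hTopUW hgW hgU hbx hcx hbx' hcx' hr₀ hb₀ hcRE hreg₁ hreg₂ hreg₃ hline hαE hθu hαE40 hθu160 hδ hδ40 hα₀ hs1 hA hσ0 haN hcN hνm hx4 hθx a hθlx hsmallG (CPLine_nonneg (L := L) (le_trans (by norm_num) hd3) (Nat.cast_nonneg (Fintype.card n)) hεc.le (hεpos.le.trans hεθ)) (classSlicePoincare_of_lines' hd3 hL (Nat.one_le_iff_ne_zero.mpr (NeZero.ne N)) hεpos hεθ hεc hε1 hε2 hK1 hK2 hK3 hK4 j W ⟨hWu, hWP, hxε ▸ hWx⟩) (regTA_class (d := d) (n := n) hd3 hL j hεpos hεθ hεc hK5 hxε) hCTdef hregP1 hregP2 hCdef hK hC0 hC1 hsmall hKB hCa hCa' hcritW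

end

end Summit.QuantumFields.BalabanUV.T4Continuum.NE7ApeCurvedRepRoadBClassEnd
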